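import Summits.ValiantsHypothesis.ValiantsHypothesis.Theorems.LacunarySymmetroidMatrixDescartesCensusDefs
import Summits.ValiantsHypothesis.ValiantsHypothesis.Theorems.LacunarySymmetroidMatrixDescartesCensusTable

/-!
# `MatrixDescartes` — Conjecture A3 (`KThreeColumnLaw`): reduction to its lower half and the kernel instances `m ≤ 6`

HONEST FRAMING.  Object-search cell `pub-symmetroid`, crux `Theses.LacunarySymmetroid.MatrixDescartes`
(stmt-ValiantsHypothesis-18050).  `KThreeColumnLaw` (the cell's Conjecture A3, «`ζ(m,3) = C(m+2,2) − 1` for all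
`m ≥ 1`», typed in the Defs module at the lead's request R28) is a CONJECTURE and is NOT asserted here.  This file
proves only: (1) A3 is equivalent to its lower half (the upper half is the Descartes ceiling, a theorem for every
`m`); (2) A3 is equivalent to its restriction to `m ≥ 7`, because the rows `m = 1 … 6` are kernel theorems
(`Census.a3_column_le_six`: `ζ = 2, 5, 9, 14, 20, 27` — these ARE the instances `m ≤ 6` of the definition, not restated here).
Finite data about small formats; nothing about the asymptotic crux or `VP ≠ VNP`.
-/

-- `Summit.ValiantsHypothesis.ValiantsHypothesis.…` repeats a component by the D-0017 layout
-- (single-conjunct summit), which the `dupNamespace` linter flags; the name is mandated.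
set_option linter.dupNamespace false

namespace Summit.ValiantsHypothesis.ValiantsHypothesis.Theorems.LacunarySymmetroidMatrixDescartes.Census

open Summit.ValiantsHypothesis.ValiantsHypothesis.Theorems.MatrixDescartes.Negative (PosRootLawAt)

/-- The upper half of A3 holds for every `m`: `ζ(m,3) ≤ C(m+2,2) − 1` is the Descartes ceiling
(`posRootLawAt_descartes m 3`, with `C(m+2, m) = C(m+2, 2)`). [folklore] -/
theorem kThreeColumn_upper (m : ℕ) : PosRootLawAt m 3 (Nat.choose (m + 2) 2 - 1) := by
  have h := posRootLawAt_descartes m 3 (by norm_num)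
  have h2 : (m + 2).choose m = (m + 2).choose 2 := Nat.choose_symm_add
  simpa [h2] using h

/-- **A3 is equivalent to its lower half**: `KThreeColumnLaw ↔ ∀ m ≥ 1, ¬ PosRootLawAt m 3 (C(m+2,2) − 2)`, i.e.
«for every size `m` some `3`-term symmetric `m × m` pencil has `C(m+2,2) − 1` distinct positive zeros». [folklore] -/
theorem kThreeColumnLaw_iff :
    KThreeColumnLaw ↔ ∀ m : ℕ, 1 ≤ m → ¬ PosRootLawAt m 3 (Nat.choose (m + 2) 2 - 2) :=
  ⟨fun h m hm => (h m hm).2, fun h m hm => ⟨kThreeColumn_upper m, h m hm⟩⟩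

/-- **What remains of A3**: `KThreeColumnLaw` is equivalent to its restriction to sizes `m ≥ 7` (lower half only).
The cell's candidate row `(7,3) = 35` (lead R27/R29, referee field-certified) is the next instance. [folklore] -/
theorem kThreeColumnLaw_iff_seven_le :
    KThreeColumnLaw ↔ ∀ m : ℕ, 7 ≤ m → ¬ PosRootLawAt m 3 (Nat.choose (m + 2) 2 - 2) := by
  rw [kThreeColumnLaw_iff]
  refine ⟨fun h m hm => h m (by omega), fun h m hm => ?_⟩
  by_cases h7 : 7 ≤ m
  · exact h m h7
  · exact (a3_column_le_six m hm (by omega)).2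

/-- **What remains of A3 after the `(7,3) = 35` row**: `KThreeColumnLaw` is equivalent to its restriction to sizes `m ≥ 8`
(lower half only), the rows `m ≤ 7` being kernel theorems (`a3_column_le_seven`; `(7,3)`: lead R27/R29, `Census.M7K3L1`). [folklore] -/
theorem kThreeColumnLaw_iff_eight_le :
    KThreeColumnLaw ↔ ∀ m : ℕ, 8 ≤ m → ¬ PosRootLawAt m 3 (Nat.choose (m + 2) 2 - 2) := by
  rw [kThreeColumnLaw_iff]
  refine ⟨fun h m hm => h m (by omega), fun h m hm => ?_⟩
  by_cases h8 : 8 ≤ m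
  · exact h m h8
  · exact (a3_column_le_seven m hm (by omega)).2

end Summit.ValiantsHypothesis.ValiantsHypothesis.Theorems.LacunarySymmetroidMatrixDescartes.Census
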